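import Mathlib
import Literature.MathematicalPhysics.QuantumFieldTheory.Luscher2010.TrivializingMaps
import Literature.MathematicalPhysics.QuantumFieldTheory.Luscher2010.FlowActionSeries
import Summits.Ventures.LatticeQCDFlow.TrivializingMaps.GaugeInvariantSeries
import Summits.Ventures.LatticeQCDFlow.TrivializingMaps.LoopActionSeriesLowDim
import Summits.Ventures.LatticeQCDFlow.TrivializingMaps.LuscherSeriesExistence
import HarnessLib

/-!
# Wilson-loop actions of closed loops are gauge invariant; so are their Lüscher series and truncated flows

HONEST FRAMING: exact (Metropolis-corrected) sampling algorithms for lattice gauge theory; figures of merit are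
autocorrelation/cost numbers at stated couplings and volumes; no continuum-physics claim.

Lüscher, CMP 293 (2010) 899, §4 (preamble), §4.4 eq. (4.19), §6: the actions are sums of Wilson LOOPS
`Re c_C tr U(C_x)` — traces of ordered products along CLOSED paths, hence gauge invariant; the flow actions
`S̃^{(k)}` and the trivializing / truncated maps inherit the gauge symmetry. With the ambient gauge action
`ambGauge` and the uniqueness-based theorem `IsLuscherSeries.isGaugeInvariant` of `GaugeInvariantSeries`,
this file proves:

* `pathProd_ambGauge`: `U(C_x)` transforms as `g(x) U(C_x) g(end of C_x)ᴴ` (ambiently, every `W ∈ M_n(ℂ)^E`);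
  `pathEnd_eq_add_count`: the end point is `x` plus the net displacement `(#(μ,→) - #(μ,←))_μ` of the word;
  so for a CLOSED word (`IsClosedWord`) the end point is `x` and `Re(c tr U(C_x))` is gauge invariant:
  `loopAction_ambGauge`, `isGaugeInvariant_loopAction` — this is the role of the closedness hypothesis of the
  cited `LuscherSeriesLocal` in `d ≥ 2`;
* the same for the plaquette action: `ambWilsonAction_ambGauge`, `isGaugeInvariant_ambWilsonAction`;
* consequences: EVERY smooth Lüscher series of a closed-loop action, of `S_W` or of `β S_W` is gauge invariant
  on `SU(n)^E` (`IsLuscherSeries.gaugeInvariant_of_loopAction`, `…_of_ambWilsonAction`, `…_of_smul_ambWilsonAction`),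
  in particular the tree's constructed series `wilsonSk` and `loopSk`
  (`isGaugeInvariant_wilsonSk`, `isGaugeInvariant_loopSk`); and the truncated Lüscher maps of `β S_W` are
  gauge EQUIVARIANT for every smooth solution (`isGaugeEquivariant_truncFlow_smul_ambWilsonAction`).

References: M. Lüscher, CMP 293 (2010) 899 [Luscher2010Trivializing, arXiv:0907.5491], §3.1, §4 (preamble),
§4.3, §4.4 eq. (4.19), §6.
-/

namespace Summit.Ventures.LatticeQCDFlow.TrivializingMaps

open MeasureTheory
open Literature.MathematicalPhysics.QuantumFieldTheory
open Literature.MathematicalPhysics.QuantumFieldTheory.Luscher2010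
open Summit.Ventures.LatticeQCDFlow.Exactness (IsGaugeEquivariant)
open scoped Matrix Matrix.Norms.Frobenius ContDiff

noncomputable section

variable {d L n : ℕ}

/-! ## §1. Loop products under the gauge action -/

/-- Unfolding the ambient gauge action at a link. [folklore] -/
theorem ambGauge_apply (g : Site d L → Matrix.specialUnitaryGroup (Fin n) ℂ) (W : AmbConfig d L n) (e : Edge d L) :
    ambGauge g W e = (g e.1 : Matrix (Fin n) (Fin n) ℂ) * W e *
      ((g (e.1.shift e.2) : Matrix.specialUnitaryGroup (Fin n) ℂ) : Matrix (Fin n) (Fin n) ℂ)ᴴ := rfl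

/-- **`U(C_x)` transforms covariantly**: `pathProd (G_g W) x w = g(x) · pathProd W x w · g(end)ᴴ`, for every
ambient configuration (only `g(y)ᴴ g(y) = 1` at the intermediate sites is used).
[cite: Luscher2010Trivializing, §4.4 eq. (4.19), §6] -/
theorem pathProd_ambGauge (g : Site d L → Matrix.specialUnitaryGroup (Fin n) ℂ) (W : AmbConfig d L n) :
    ∀ (w : PathWord d) (x : Site d L), pathProd (ambGauge g W) x w =
      (g x : Matrix (Fin n) (Fin n) ℂ) * pathProd W x w *
        ((g (pathEnd x w) : Matrix.specialUnitaryGroup (Fin n) ℂ) : Matrix (Fin n) (Fin n) ℂ)ᴴ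
  | [], x => by
      rw [pathProd_nil, pathProd_nil, Matrix.mul_one]
      exact (WilsonFlow.mul_conjTranspose_self_SU (g x)).symm
  | (μ, true) :: w, x => by
      have hend : pathEnd x ((μ, true) :: w) = pathEnd (x.shift μ) w := rfl
      rw [pathProd_cons_true, pathProd_cons_true, pathProd_ambGauge g W w (x.shift μ), ambGauge_apply, hend]
      simp only [Matrix.mul_assoc]
      rw [← Matrix.mul_assoc (((g ((x, μ).1.shift (x, μ).2) : Matrix.specialUnitaryGroup (Fin n) ℂ) :
          Matrix (Fin n) (Fin n) ℂ)ᴴ), WilsonFlow.conjTranspose_mul_self_SU, Matrix.one_mul]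
  | (μ, false) :: w, x => by
      have hend : pathEnd x ((μ, false) :: w) = pathEnd (x - Pi.single μ 1) w := rfl
      have hs : (x - Pi.single μ 1, μ).1.shift (x - Pi.single μ 1, μ).2 = x := by simp [Site.shift]
      rw [pathProd_cons_false, pathProd_cons_false, pathProd_ambGauge g W w (x - Pi.single μ 1),
        ambGauge_apply, hs, hend]
      simp only [Matrix.conjTranspose_mul, Matrix.conjTranspose_conjTranspose, Matrix.mul_assoc]
      rw [← Matrix.mul_assoc (((g (x - Pi.single μ 1, μ).1 : Matrix.specialUnitaryGroup (Fin n) ℂ) :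
          Matrix (Fin n) (Fin n) ℂ)ᴴ), WilsonFlow.conjTranspose_mul_self_SU, Matrix.one_mul]

/-- One letter changes one count: `#(μ,c)` in `(ν,b) :: w`. [folklore] -/
theorem count_cons_letter (ν μ : Fin d) (b c : Bool) (w : PathWord d) :
    List.count (μ, c) ((ν, b) :: w) = List.count (μ, c) w + if ν = μ ∧ b = c then 1 else 0 := by
  rw [List.count_cons]
  congr 1
  by_cases h : ν = μ ∧ b = c
  · rw [if_pos h, if_pos]; simp [h.1, h.2]
  · rw [if_neg h, if_neg]; simpa [Prod.mk.injEq] using h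

/-- **The end point of a path is its start plus the net displacement of the word**:
`end = x + (#(μ,→) - #(μ,←))_μ` (counts read in `ℤ/Lℤ`). [folklore] -/
theorem pathEnd_eq_add_count : ∀ (w : PathWord d) (x : Site d L),
    pathEnd x w = x + fun μ => ((w.count (μ, true) : ZMod L) - (w.count (μ, false) : ZMod L))
  | [], x => by funext μ; simp [pathEnd]
  | (ν, true) :: w, x => by
      have hend : pathEnd x ((ν, true) :: w) = pathEnd (x.shift ν) w := rfl
      rw [hend, pathEnd_eq_add_count w (x.shift ν)]
      funext μ
      simp only [Site.shift, Pi.add_apply, count_cons_letter, and_true, Pi.single_apply]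
      by_cases h : ν = μ
      · subst h
        simp only [if_true, Bool.true_eq_false, and_false, if_false, Nat.add_zero]
        push_cast
        ring
      · have h2 : ¬μ = ν := fun h' => h h'.symm
        simp [h, h2]
  | (ν, false) :: w, x => by
      have hend : pathEnd x ((ν, false) :: w) = pathEnd (x - Pi.single ν 1) w := rfl
      rw [hend, pathEnd_eq_add_count w (x - Pi.single ν 1)]
      funext μ
      simp only [Pi.add_apply, Pi.sub_apply, count_cons_letter, and_true, Pi.single_apply]
      by_cases h : ν = μ
      · subst h
        simp only [if_true, Bool.false_eq_true, and_false, if_false, Nat.add_zero]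
        push_cast
        ring
      · have h2 : ¬μ = ν := fun h' => h h'.symm
        simp [h, h2]

/-- **A closed word returns to its starting point** on every periodic lattice. [cite: Luscher2010Trivializing, §4 (preamble)] -/
theorem pathEnd_eq_self_of_closed {w : PathWord d} (hw : IsClosedWord w) (x : Site d L) : pathEnd x w = x := by
  have h0 : (fun μ => ((w.count (μ, true) : ZMod L) - (w.count (μ, false) : ZMod L))) = 0 := by
    funext μ
    rw [hw μ, sub_self]
    rfl
  rw [pathEnd_eq_add_count, h0, add_zero]

variable [NeZero L]

/-- **A Wilson-loop action of CLOSED loops is invariant under the ambient gauge action**: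
`S(G_g W) = S(W)` for every `W ∈ M_n(ℂ)^E`. [cite: Luscher2010Trivializing, §4 (preamble), §4.4 eq. (4.19)] -/
theorem loopAction_ambGauge {shapes : Finset (PathWord d)} (coef : PathWord d → ℂ)
    (hcl : ∀ w ∈ shapes, IsClosedWord w) (g : Site d L → Matrix.specialUnitaryGroup (Fin n) ℂ)
    (W : AmbConfig d L n) : loopAction shapes coef (ambGauge g W) = loopAction shapes coef W := by
  refine Finset.sum_congr rfl fun x _ => Finset.sum_congr rfl fun w hw => ?_
  rw [pathProd_ambGauge, pathEnd_eq_self_of_closed (hcl w hw), Matrix.trace_mul_cycle,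
    WilsonFlow.conjTranspose_mul_self_SU, Matrix.one_mul]

/-- Hence a closed-loop action is gauge invariant on the field manifold `SU(n)^E`.
[cite: Luscher2010Trivializing, §4 (preamble), §6] -/
theorem isGaugeInvariant_loopAction {shapes : Finset (PathWord d)} (coef : PathWord d → ℂ)
    (hcl : ∀ w ∈ shapes, IsClosedWord w) :
    IsGaugeInvariant fun U : GaugeConfig d L (Matrix.specialUnitaryGroup (Fin n) ℂ) =>
      loopAction shapes coef (WilsonFlow.coeConfig U) := by
  intro g U
  show loopAction shapes coef (WilsonFlow.coeConfig (gaugeTransform g U)) = _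
  rw [← ambGauge_coeConfig, loopAction_ambGauge coef hcl]

/-- **The plaquette action is invariant under the ambient gauge action** (`(x+μ̂)+ν̂ = (x+ν̂)+μ̂`).
[cite: Luscher2010Trivializing, §4.4 eq. (4.16), §6] -/
theorem ambWilsonAction_ambGauge (g : Site d L → Matrix.specialUnitaryGroup (Fin n) ℂ) (W : AmbConfig d L n) :
    ambWilsonAction (ambGauge g W) = ambWilsonAction W := by
  unfold ambWilsonAction
  refine Finset.sum_congr rfl fun x _ => Finset.sum_congr rfl fun μ _ => Finset.sum_congr rfl fun ν _ => ?_
  split_ifs with h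
  · have hshift : (x.shift μ).shift ν = (x.shift ν).shift μ := by
      simp only [Site.shift, add_assoc, add_comm (Pi.single (M := fun _ => ZMod L) μ 1)]
    have hP : ambGauge g W (x, μ) * ambGauge g W (x.shift μ, ν) * (ambGauge g W (x.shift ν, μ))ᴴ *
        (ambGauge g W (x, ν))ᴴ =
        (g x : Matrix (Fin n) (Fin n) ℂ) * (W (x, μ) * W (x.shift μ, ν) * (W (x.shift ν, μ))ᴴ * (W (x, ν))ᴴ) *
          (g x : Matrix (Fin n) (Fin n) ℂ)ᴴ := by
      simp only [ambGauge, hshift, Matrix.conjTranspose_mul, Matrix.conjTranspose_conjTranspose,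
        Matrix.mul_assoc]
      rw [← Matrix.mul_assoc (((g (x.shift μ) : Matrix.specialUnitaryGroup (Fin n) ℂ) :
          Matrix (Fin n) (Fin n) ℂ)ᴴ), WilsonFlow.conjTranspose_mul_self_SU, Matrix.one_mul,
        ← Matrix.mul_assoc (((g ((x.shift ν).shift μ) : Matrix.specialUnitaryGroup (Fin n) ℂ) :
          Matrix (Fin n) (Fin n) ℂ)ᴴ), WilsonFlow.conjTranspose_mul_self_SU, Matrix.one_mul,
        ← Matrix.mul_assoc (((g (x.shift ν) : Matrix.specialUnitaryGroup (Fin n) ℂ) :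
          Matrix (Fin n) (Fin n) ℂ)ᴴ), WilsonFlow.conjTranspose_mul_self_SU, Matrix.one_mul]
    have h1 : (1 : Matrix (Fin n) (Fin n) ℂ) - (g x : Matrix (Fin n) (Fin n) ℂ) *
        (W (x, μ) * W (x.shift μ, ν) * (W (x.shift ν, μ))ᴴ * (W (x, ν))ᴴ) * (g x : Matrix (Fin n) (Fin n) ℂ)ᴴ =
        (g x : Matrix (Fin n) (Fin n) ℂ) * (1 - W (x, μ) * W (x.shift μ, ν) * (W (x.shift ν, μ))ᴴ * (W (x, ν))ᴴ) *
          (g x : Matrix (Fin n) (Fin n) ℂ)ᴴ := by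
      rw [Matrix.mul_sub, Matrix.sub_mul, Matrix.mul_one, WilsonFlow.mul_conjTranspose_self_SU]
    rw [hP, h1, Matrix.trace_mul_cycle, WilsonFlow.conjTranspose_mul_self_SU, Matrix.one_mul]
  · rfl

/-- Hence the plaquette action is gauge invariant on `SU(n)^E` (Lüscher's `S_W ∘ ι`; Wave 0 proves the
analogue for its `wilsonAction`). [cite: Luscher2010Trivializing, §6] -/
theorem isGaugeInvariant_ambWilsonAction :
    IsGaugeInvariant fun U : GaugeConfig d L (Matrix.specialUnitaryGroup (Fin n) ℂ) =>
      ambWilsonAction (WilsonFlow.coeConfig U) := by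
  intro g U
  show ambWilsonAction (WilsonFlow.coeConfig (gaugeTransform g U)) = _
  rw [← ambGauge_coeConfig, ambWilsonAction_ambGauge]

/-- `β S_W ∘ ι` is gauge invariant. [folklore] -/
theorem isGaugeInvariant_smul_ambWilsonAction (β : ℝ) :
    IsGaugeInvariant fun U : GaugeConfig d L (Matrix.specialUnitaryGroup (Fin n) ℂ) =>
      (fun W : AmbConfig d L n => β * ambWilsonAction W) (WilsonFlow.coeConfig U) :=
  fun g U => congrArg (fun r : ℝ => β * r) (isGaugeInvariant_ambWilsonAction g U)

/-! ## §2. Smoothness of loop actions in every dimension -/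

/-- `W ↦ U(C_x)` is smooth (a product of link variables and their adjoints). [folklore] -/
theorem contDiff_pathProd : ∀ (w : PathWord d) (x : Site d L),
    ContDiff ℝ ∞ fun W : AmbConfig d L n => pathProd W x w
  | [], x => by simp only [pathProd_nil]; exact contDiff_const
  | (μ, true) :: w, x => by
      simp only [pathProd_cons_true]
      exact (WilsonFlow.contDiff_eval (x, μ)).mul (contDiff_pathProd w (x.shift μ))
  | (μ, false) :: w, x => by
      simp only [pathProd_cons_false]
      exact (WilsonFlow.contDiff_eval_conjTranspose _).mul (contDiff_pathProd w _)

/-- A loop action is smooth on ambient configurations (every `d`). [folklore] -/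
theorem contDiff_loopAction' (shapes : Finset (PathWord d)) (coef : PathWord d → ℂ) :
    ContDiff ℝ ∞ (loopAction shapes coef : AmbConfig d L n → ℝ) := by
  unfold loopAction
  refine ContDiff.sum fun x _ => ContDiff.sum fun w _ => ?_
  exact Complex.reCLM.contDiff.comp
    (contDiff_const.mul (WilsonFlow.contDiff_trace.comp (contDiff_pathProd w x)))

/-! ## §3. Gauge invariance of Lüscher series; equivariance of truncated maps -/

/-- **Every smooth Lüscher series of a closed-loop action is gauge invariant on `SU(n)^E`.**
[cite: Luscher2010Trivializing, §4.3, §6] -/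
theorem IsLuscherSeries.gaugeInvariant_of_loopAction {B : SuBasis n} {shapes : Finset (PathWord d)}
    {coef : PathWord d → ℂ} (hcl : ∀ w ∈ shapes, IsClosedWord w) {Sk : ℕ → AmbConfig d L n → ℝ} {c : ℕ → ℝ}
    (h : IsLuscherSeries B (loopAction shapes coef) Sk c) (hsm : ∀ k, ContDiff ℝ ∞ (Sk k)) (k : ℕ) :
    IsGaugeInvariant fun U : GaugeConfig d L (Matrix.specialUnitaryGroup (Fin n) ℂ) =>
      Sk k (WilsonFlow.coeConfig U) :=
  IsLuscherSeries.isGaugeInvariant h (isGaugeInvariant_loopAction coef hcl)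
    ((contDiff_loopAction' shapes coef).differentiable (by simp)) hsm k

/-- **Every smooth Lüscher series of the Wilson plaquette action is gauge invariant on `SU(n)^E`.**
[cite: Luscher2010Trivializing, §4.3, §6] -/
theorem IsLuscherSeries.gaugeInvariant_of_ambWilsonAction {B : SuBasis n} {Sk : ℕ → AmbConfig d L n → ℝ}
    {c : ℕ → ℝ} (h : IsLuscherSeries B ambWilsonAction Sk c) (hsm : ∀ k, ContDiff ℝ ∞ (Sk k)) (k : ℕ) :
    IsGaugeInvariant fun U : GaugeConfig d L (Matrix.specialUnitaryGroup (Fin n) ℂ) =>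
      Sk k (WilsonFlow.coeConfig U) :=
  IsLuscherSeries.isGaugeInvariant h isGaugeInvariant_ambWilsonAction
    (contDiff_ambWilsonAction.differentiable (by simp)) hsm k

/-- The same for the coupling-scaled action `β S_W` (theory-1's convention). [cite: Luscher2010Trivializing, §4.3, §6] -/
theorem IsLuscherSeries.gaugeInvariant_of_smul_ambWilsonAction {B : SuBasis n} (β : ℝ)
    {Sk : ℕ → AmbConfig d L n → ℝ} {c : ℕ → ℝ}
    (h : IsLuscherSeries B (fun W : AmbConfig d L n => β * ambWilsonAction W) Sk c)
    (hsm : ∀ k, ContDiff ℝ ∞ (Sk k)) (k : ℕ) :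
    IsGaugeInvariant fun U : GaugeConfig d L (Matrix.specialUnitaryGroup (Fin n) ℂ) =>
      Sk k (WilsonFlow.coeConfig U) :=
  IsLuscherSeries.isGaugeInvariant h (isGaugeInvariant_smul_ambWilsonAction β)
    ((contDiff_const.mul contDiff_ambWilsonAction).differentiable (by simp)) hsm k

/-- The tree's constructed Wilson series `wilsonSk` is gauge invariant on `SU(n)^E`. [folklore] -/
theorem isGaugeInvariant_wilsonSk (B : SuBasis n) (k : ℕ) :
    IsGaugeInvariant fun U : GaugeConfig d L (Matrix.specialUnitaryGroup (Fin n) ℂ) =>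
      wilsonSk d L B k (WilsonFlow.coeConfig U) :=
  IsLuscherSeries.gaugeInvariant_of_ambWilsonAction (isLuscherSeries_wilsonSk B) (contDiff_wilsonSk B) k

/-- The constructed loop-action series `loopSk` is gauge invariant on `SU(n)^E` (closed words, `d ≥ 2`).
[folklore] -/
theorem isGaugeInvariant_loopSk (hd : 2 ≤ d) (B : SuBasis n) {shapes : Finset (PathWord d)}
    (coef : PathWord d → ℂ) (hcl : ∀ w ∈ shapes, IsClosedWord w) (ν₀ : Fin d) (k : ℕ) :
    IsGaugeInvariant fun U : GaugeConfig d L (Matrix.specialUnitaryGroup (Fin n) ℂ) =>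
      loopSk hd B shapes coef ν₀ L k (WilsonFlow.coeConfig U) :=
  IsLuscherSeries.gaugeInvariant_of_loopAction hcl (isLuscherSeries_loopSk hd B shapes coef ν₀ L)
    (contDiff_loopSk hd B shapes coef ν₀ L) k

/-- **The truncated Lüscher maps of `β S_W` are gauge EQUIVARIANT**, for every smooth solution of the
recursion and every truncation order `N`, given uniqueness of the flow lines of `Z_t = -∂S̃^{[N]}_t`
("the map preserves the gauge symmetry"). [cite: Luscher2010Trivializing, §4.5(c), §6] -/
theorem isGaugeEquivariant_truncFlow_smul_ambWilsonAction (B : SuBasis n) (β : ℝ)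
    {Sk : ℕ → AmbConfig d L n → ℝ} {c : ℕ → ℝ}
    (h : IsLuscherSeries B (fun W : AmbConfig d L n => β * ambWilsonAction W) Sk c)
    (hSk : ∀ k, ContDiff ℝ ∞ (Sk k)) (N : ℕ)
    {Φ : ℝ → GaugeConfig d L (Matrix.specialUnitaryGroup (Fin n) ℂ) →
      GaugeConfig d L (Matrix.specialUnitaryGroup (Fin n) ℂ)}
    (hΦ : IsFlowMap (fun t W => -linkGrad B (truncFlowAction Sk t N) W) Φ)
    (huniq : ∀ (U : ℝ → AmbConfig d L n) (V : GaugeConfig d L (Matrix.specialUnitaryGroup (Fin n) ℂ)),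
      IsFlowLine (fun t W => -linkGrad B (truncFlowAction Sk t N) W) U → U 0 = WilsonFlow.coeConfig V →
        ∀ t, U t = WilsonFlow.coeConfig (Φ t V))
    (t : ℝ) : IsGaugeEquivariant (Φ t) :=
  isGaugeEquivariant_truncFlow_of_isLuscherSeries B h (isGaugeInvariant_smul_ambWilsonAction β)
    ((contDiff_const.mul contDiff_ambWilsonAction).differentiable (by simp)) hSk N hΦ huniq t

/-- The same for a closed-loop action. [cite: Luscher2010Trivializing, §4.5(c), §6] -/
theorem isGaugeEquivariant_truncFlow_loopAction (B : SuBasis n) {shapes : Finset (PathWord d)}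
    (coef : PathWord d → ℂ) (hcl : ∀ w ∈ shapes, IsClosedWord w) {Sk : ℕ → AmbConfig d L n → ℝ} {c : ℕ → ℝ}
    (h : IsLuscherSeries B (loopAction shapes coef) Sk c) (hSk : ∀ k, ContDiff ℝ ∞ (Sk k)) (N : ℕ)
    {Φ : ℝ → GaugeConfig d L (Matrix.specialUnitaryGroup (Fin n) ℂ) →
      GaugeConfig d L (Matrix.specialUnitaryGroup (Fin n) ℂ)}
    (hΦ : IsFlowMap (fun t W => -linkGrad B (truncFlowAction Sk t N) W) Φ)
    (huniq : ∀ (U : ℝ → AmbConfig d L n) (V : GaugeConfig d L (Matrix.specialUnitaryGroup (Fin n) ℂ)),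
      IsFlowLine (fun t W => -linkGrad B (truncFlowAction Sk t N) W) U → U 0 = WilsonFlow.coeConfig V →
        ∀ t, U t = WilsonFlow.coeConfig (Φ t V))
    (t : ℝ) : IsGaugeEquivariant (Φ t) :=
  isGaugeEquivariant_truncFlow_of_isLuscherSeries B h (isGaugeInvariant_loopAction coef hcl)
    ((contDiff_loopAction' shapes coef).differentiable (by simp)) hSk N hΦ huniq t

end

end Summit.Ventures.LatticeQCDFlow.TrivializingMaps
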